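import Summits.RiemannHypothesis.RiemannHypothesis.Theorems.TiltedLandingLaw421R3GenusOneLogDeriv
import Literature.Barriers.RiemannHypothesis.EpsteinZetaStark
import Literature.NumberTheory.LFunctions.NymanBeurlingVectorsOrthogonal

/-!
# Genus-one log-derivative (2/3): zero form; the cofactor at a simple zero; growth normalisation and translation

Continues the tree's `TiltedLandingLaw421R3GenusOneLogDeriv` (the product log-derivative `F'/F = A + Σ (−bₙ²x)/(1 − bₙx)`,
the EXACT two-point identity and its bound `norm_logDeriv_sub_logDeriv_le`, `exists_twoPoint_bound`) in the same namespace.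
Everything here is PROVED (standard axioms). AI-produced formalisation (planner-rh-idea-3-g41-0, W-08 cell C3 «analysis»,
2026-08-30; helper toward crux 33346 `TiltedLandingLaw421R` — the Newton door of `RhW08.NewtonDoor`; nothing here bears on the
truth of RH, RH is not proved); AI review is weaker than expert review.

* `mult`, `twoPoint_term_eq_zeroForm`, `logDeriv_sub_logDeriv_eq_tsum_zeros` — the two-point identity in the ZERO form
  `Σₙ mₙ (1/(z − aₙ) − 1/(v − aₙ))`, `aₙ = bₙ⁻¹`, `mₙ ∈ {0, 1}`;
* `differentiable_dslope_of_differentiable`, `norm_dslope_le` — the cofactor `h = dslope F v` at a zero `v` is entire with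
  `‖h z‖ ≤ C e^{(‖v‖+1)^ρ} e^{‖z‖^ρ}` (maximum modulus on `‖z − v‖ = 1`); `dslope_twoPoint` — the two-point identity/bound
  for `h` in inverse-zero coordinates (still with `F 0 ≠ 0`, `0 ≤ ρ`);
* `growth_nonneg_exponent`, `growth_translate` — WLOG `0 ≤ ρ`; `‖F (x + c)‖ ≤ C' e^{‖x‖^{ρ'}}` for any `ρ' > ρ ≥ 0`;
* `deriv_ne_zero_of_analyticOrderAt_eq_one`, `analyticOrderNatAt_pos_of_zero` (identity theorem), `summable_end_majorant`
  (END tail `≤ 2‖bₙ‖²`), `hasSum_fiber_ncard` (a list-sum is the fiber-count-weighted point sum).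
Part 3/3 (`…R3GenusOneLogDeriv3`) assembles `twoPoint_bound_dslope`. [cite: Conway1978, Ch. XI Thm. 3.4] [cite: Boas1954, §2.7, §2.10]

## References
* R. P. Boas, *Entire Functions*, Academic Press 1954, §2.7 (Hadamard factorisation), §2.10 (genus; order `< 2` ⇒ `Σ |aₙ|⁻² < ∞`).
* J. B. Conway, *Functions of One Complex Variable I*, GTM 11, Ch. XI Thm. 3.4 (Hadamard).
* B. Ya. Levin, *Lectures on Entire Functions*, AMS 1996, Lectures 4–5.
-/

noncomputable section

open Complex Filter Topology Set

namespace Literature.Analysis.Complex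

namespace GenusOneLogDerivC3g41

/-! ## The zero form `Σ m (1/(z − a) − 1/(v − a))` (C1 g28's series-door interface, RIDER-15) -/

/-- Indicator multiplicity of the Hadamard datum `bₙ`: `0` for padding (`bₙ = 0`), `1` for an inverse zero. -/
def mult (b : ℕ → ℂ) (n : ℕ) : ℝ := if b n = 0 then 0 else 1

/-- (K) `mult b n ≥ 0` (by definition: `0` or `1`). -/
theorem mult_nonneg (b : ℕ → ℂ) (n : ℕ) : 0 ≤ mult b n := by
  unfold mult; split_ifs <;> norm_num

/-- Termwise: `b²(v − z)/((1 − bz)(1 − bv)) = m · (1/(z − b⁻¹) − 1/(v − b⁻¹))`, `m = [b ≠ 0]`. -/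
theorem twoPoint_term_eq_zeroForm {b : ℕ → ℂ} (n : ℕ) {z v : ℂ} (hz : 1 - b n * z ≠ 0)
    (hv : 1 - b n * v ≠ 0) :
    (b n) ^ 2 * (v - z) / ((1 - b n * z) * (1 - b n * v)) =
      ((mult b n : ℝ) : ℂ) * (1 / (z - (b n)⁻¹) - 1 / (v - (b n)⁻¹)) := by
  unfold mult
  by_cases hb : b n = 0
  · simp [hb]
  · have hza : z - (b n)⁻¹ ≠ 0 := by
      intro h; apply hz
      have : z = (b n)⁻¹ := sub_eq_zero.1 h
      rw [this, mul_inv_cancel₀ hb, sub_self]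
    have hva : v - (b n)⁻¹ ≠ 0 := by
      intro h; apply hv
      have : v = (b n)⁻¹ := sub_eq_zero.1 h
      rw [this, mul_inv_cancel₀ hb, sub_self]
    have e : ∀ w : ℂ, 1 - b n * w ≠ 0 → w - (b n)⁻¹ ≠ 0 →
        1 / (w - (b n)⁻¹) = -(b n) / (1 - b n * w) := by
      intro w hw hwa
      rw [div_eq_div_iff hwa hw]
      have : b n * (b n)⁻¹ = 1 := mul_inv_cancel₀ hb
      linear_combination (-1 : ℂ) * this
    simp only [hb, if_false, Complex.ofReal_one, one_mul]
    rw [e z hz hza, e v hv hva, div_sub_div _ _ hz hv, div_eq_div_iff (mul_ne_zero hz hv) (mul_ne_zero hz hv)]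
    ring

/-- **Two-point identity, zero form.** Off the zeros,
`F'/F (z) − F'/F (v) = Σₙ mₙ (1/(z − aₙ) − 1/(v − aₙ))` with `aₙ = bₙ⁻¹`, `mₙ = [bₙ ≠ 0]`
(each zero of `F` occurring `analyticOrderNatAt` times among the `aₙ`), the series being summable. -/
theorem logDeriv_sub_logDeriv_eq_tsum_zeros {F : ℂ → ℂ} (h0 : F 0 ≠ 0) {A : ℂ} {b : ℕ → ℂ}
    (hb : Summable fun n ↦ ‖b n‖ ^ 2)
    (hprod : ∀ z : ℂ, HasProd (fun n ↦ (1 - b n * z) * exp (b n * z)) (F z / (F 0 * exp (A * z))))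
    {z v : ℂ} (hz : F z ≠ 0) (hv : F v ≠ 0) (hFz : DifferentiableAt ℂ F z)
    (hFv : DifferentiableAt ℂ F v) :
    Summable (fun n ↦ ((mult b n : ℝ) : ℂ) * (1 / (z - (b n)⁻¹) - 1 / (v - (b n)⁻¹))) ∧
    logDeriv F z - logDeriv F v =
      ∑' n, ((mult b n : ℝ) : ℂ) * (1 / (z - (b n)⁻¹) - 1 / (v - (b n)⁻¹)) := by
  have hcongr : ∀ n, (b n) ^ 2 * (v - z) / ((1 - b n * z) * (1 - b n * v)) =
      ((mult b n : ℝ) : ℂ) * (1 / (z - (b n)⁻¹) - 1 / (v - (b n)⁻¹)) := fun n ↦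
    twoPoint_term_eq_zeroForm n (one_sub_mul_ne_zero_of_hasProd hprod h0 hz n)
      (one_sub_mul_ne_zero_of_hasProd hprod h0 hv n)
  have hterm : ∀ n, ‖(b n) ^ 2 * (v - z) / ((1 - b n * z) * (1 - b n * v))‖ =
      ‖z - v‖ * (‖b n‖ ^ 2 / (‖1 - b n * z‖ * ‖1 - b n * v‖)) := by
    intro n
    rw [norm_div, norm_mul, norm_mul, norm_pow, norm_sub_rev v z]
    ring
  have hs : Summable fun n ↦ (b n) ^ 2 * (v - z) / ((1 - b n * z) * (1 - b n * v)) := by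
    refine Summable.of_norm ?_
    simp only [hterm]
    exact (summable_twoPoint_terms hb z v).mul_left _
  refine ⟨(hs.congr hcongr), ?_⟩
  rw [logDeriv_sub_logDeriv_eq_tsum h0 hb hprod hz hv hFz hFv]
  exact tsum_congr hcongr

/-! ## The cofactor at a simple zero: `h = dslope F v`, `K = h'(v)/h(v)` -/

/-- (K) alias for `Literature.NumberTheory.LFunctions.BurnolVectors.differentiable_dslope`. -/
private abbrev differentiable_dslope_of_differentiable := @Literature.NumberTheory.LFunctions.BurnolVectors.differentiable_dslope

/-- Growth of the cofactor at a zero: `‖dslope F v z‖ ≤ C e^{(‖v‖+1)^ρ} · e^{‖z‖^ρ}` (maximum modulus on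
`‖z − v‖ ≤ 1`, the trivial bound outside). -/
theorem norm_dslope_le {F : ℂ → ℂ} {ρ C : ℝ} (hF : Differentiable ℂ F) (hρ0 : 0 ≤ ρ)
    (hbound : ∀ z, ‖F z‖ ≤ C * Real.exp (‖z‖ ^ ρ)) {v : ℂ} (hv : F v = 0) (z : ℂ) :
    ‖dslope F v z‖ ≤ C * Real.exp ((‖v‖ + 1) ^ ρ) * Real.exp (‖z‖ ^ ρ) := by
  have hC : 0 ≤ C := by
    have h1 : (0 : ℝ) ≤ C * Real.exp (‖(0 : ℂ)‖ ^ ρ) := (norm_nonneg _).trans (hbound 0)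
    exact (mul_nonneg_iff_of_pos_right (Real.exp_pos _)).1 h1
  have hfar : ∀ w : ℂ, w ≠ v → ‖dslope F v w‖ = ‖F w‖ / ‖w - v‖ := by
    intro w hw
    rw [dslope_of_ne _ hw, slope_def_field, hv, sub_zero, norm_div]
  have hE1 : 1 ≤ Real.exp ((‖v‖ + 1) ^ ρ) := Real.one_le_exp (by positivity)
  have hEz : 1 ≤ Real.exp (‖z‖ ^ ρ) := Real.one_le_exp (by positivity)
  by_cases hz : 1 ≤ ‖z - v‖
  · have hne : z ≠ v := by
      intro h; rw [h, sub_self, norm_zero] at hz; exact absurd hz (by norm_num)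
    rw [hfar z hne]
    calc ‖F z‖ / ‖z - v‖ ≤ ‖F z‖ := div_le_self (norm_nonneg _) hz
      _ ≤ C * Real.exp (‖z‖ ^ ρ) := hbound z
      _ ≤ C * Real.exp ((‖v‖ + 1) ^ ρ) * Real.exp (‖z‖ ^ ρ) := by
          have h3 : 0 ≤ C * Real.exp (‖z‖ ^ ρ) := by positivity
          nlinarith
  · push Not at hz
    have hmax : ‖dslope F v z‖ ≤ C * Real.exp ((‖v‖ + 1) ^ ρ) := by
      refine Complex.norm_le_of_forall_mem_frontier_norm_le (U := Metric.ball v 1)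
        Metric.isBounded_ball (differentiable_dslope_of_differentiable hF v).diffContOnCl ?_ ?_
      · intro ζ hζ
        rw [frontier_ball v one_ne_zero] at hζ
        have h1 : ‖ζ - v‖ = 1 := by
          simpa [Metric.mem_sphere, dist_eq_norm] using hζ
        have hne : ζ ≠ v := by
          intro h; rw [h, sub_self, norm_zero] at h1; exact absurd h1 (by norm_num)
        rw [hfar ζ hne, h1, div_one]
        have hζn : ‖ζ‖ ≤ ‖v‖ + 1 := by
          have := norm_le_norm_add_norm_sub' ζ v  -- ‖ζ‖ ≤ ‖v‖ + ‖ζ - v‖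
          linarith
        calc ‖F ζ‖ ≤ C * Real.exp (‖ζ‖ ^ ρ) := hbound ζ
          _ ≤ C * Real.exp ((‖v‖ + 1) ^ ρ) := by
              have : ‖ζ‖ ^ ρ ≤ (‖v‖ + 1) ^ ρ := Real.rpow_le_rpow (norm_nonneg _) hζn hρ0
              gcongr
      · exact subset_closure (Metric.mem_ball.2 (by rwa [dist_eq_norm]))
    calc ‖dslope F v z‖ ≤ C * Real.exp ((‖v‖ + 1) ^ ρ) := hmax
      _ ≤ C * Real.exp ((‖v‖ + 1) ^ ρ) * Real.exp (‖z‖ ^ ρ) :=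
          le_mul_of_one_le_right (by positivity) hEz

/-- **The exact Newton-door input (C1 g28 RIDER-15 `succ_of_newton_door_tsum`, hypothesis «two-point identity»).**
`F` entire with `‖F z‖ ≤ C e^{‖z‖^ρ}`, `0 ≤ ρ < 2`, `F 0 ≠ 0`, `v` a SIMPLE zero, `h := dslope F v` (so
`K = h'(v)/h(v) = F''(v)/(2F'(v))`). Then there are Hadamard data `b` for `h` (`Σ‖bₙ‖² < ∞`; the non-zero `bₙ` are
the inverse zeros `aₙ = bₙ⁻¹ ≠ v` of `F`, each zero `a ≠ 0` of `h` hit `analyticOrderNatAt h a` times) such that for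
every non-zero `z` of `F`: the zero-form series is summable,
`h'/h (z) − h'/h (v) = Σₙ mₙ (1/(z − aₙ) − 1/(v − aₙ))`, and
`‖h'/h (z) − h'/h (v)‖ ≤ ‖z − v‖ · Σₙ ‖bₙ‖²/(‖1 − bₙ z‖ ‖1 − bₙ v‖)` — no Landau constant, no radii. -/
theorem dslope_twoPoint (F : ℂ → ℂ) (ρ C : ℝ) (hF : Differentiable ℂ F) (hρ0 : 0 ≤ ρ) (hρ : ρ < 2)
    (hbound : ∀ z, ‖F z‖ ≤ C * Real.exp (‖z‖ ^ ρ)) (h0 : F 0 ≠ 0) {v : ℂ} (hv : F v = 0)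
    (hv1 : deriv F v ≠ 0) :
    ∃ b : ℕ → ℂ, Summable (fun n ↦ ‖b n‖ ^ 2) ∧
      (∀ n, b n ≠ 0 → F (b n)⁻¹ = 0 ∧ (b n)⁻¹ ≠ v) ∧
      (∀ a : ℂ, a ≠ 0 → {n : ℕ | b n = a⁻¹}.ncard = analyticOrderNatAt (dslope F v) a) ∧
      ∀ z : ℂ, F z ≠ 0 →
        Summable (fun n ↦ ((mult b n : ℝ) : ℂ) * (1 / (z - (b n)⁻¹) - 1 / (v - (b n)⁻¹))) ∧
        logDeriv (dslope F v) z - logDeriv (dslope F v) v =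
          ∑' n, ((mult b n : ℝ) : ℂ) * (1 / (z - (b n)⁻¹) - 1 / (v - (b n)⁻¹)) ∧
        ‖logDeriv (dslope F v) z - logDeriv (dslope F v) v‖ ≤
          ‖z - v‖ * ∑' n, ‖b n‖ ^ 2 / (‖1 - b n * z‖ * ‖1 - b n * v‖) := by
  set h : ℂ → ℂ := dslope F v with hh
  have hhd : Differentiable ℂ h := differentiable_dslope_of_differentiable hF v
  have hhb : ∀ z, ‖h z‖ ≤ (C * Real.exp ((‖v‖ + 1) ^ ρ)) * Real.exp (‖z‖ ^ ρ) :=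
    fun z ↦ norm_dslope_le hF hρ0 hbound hv z
  have hv0 : v ≠ 0 := by intro h'; rw [h'] at hv; exact h0 hv
  -- values of `h` off the zero: `h w = F w / (w − v)`
  have hval : ∀ w : ℂ, w ≠ v → h w = F w / (w - v) := by
    intro w hw
    rw [hh, dslope_of_ne _ hw, slope_def_field, hv, sub_zero]
  have hh0 : h 0 ≠ 0 := by
    rw [hval 0 (Ne.symm hv0)]
    exact div_ne_zero h0 (sub_ne_zero.2 (Ne.symm hv0))
  have hhv : h v ≠ 0 := by rw [hh, dslope_same]; exact hv1
  have hhz : ∀ z, F z ≠ 0 → h z ≠ 0 := by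
    intro z hz
    have hzv : z ≠ v := by intro e; rw [e] at hz; exact hz hv
    rw [hval z hzv]
    exact div_ne_zero hz (sub_ne_zero.2 hzv)
  obtain ⟨b, hb, hzero, hmult, hprod⟩ :=
    hadamard_genus_one_zeros h ρ (C * Real.exp ((‖v‖ + 1) ^ ρ)) hhd hρ hhb hh0
  refine ⟨b, hb, fun n hn ↦ ?_, hmult, fun z hz ↦ ?_⟩
  · have hz' : h (b n)⁻¹ = 0 := hzero n hn
    have hne : (b n)⁻¹ ≠ v := by intro e; rw [e] at hz'; exact hhv hz'
    refine ⟨?_, hne⟩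
    have := sub_smul_dslope F v (b n)⁻¹
    rw [hv, sub_zero, ← hh, hz', smul_zero] at this
    exact this.symm
  · obtain ⟨hs, hid⟩ := logDeriv_sub_logDeriv_eq_tsum_zeros hh0 hb hprod (hhz z hz) hhv (hhd z) (hhd v)
    exact ⟨hs, hid, norm_logDeriv_sub_logDeriv_le hh0 hb hprod (hhz z hz) hhv (hhd z) (hhd v)⟩

/-! ## Removing `F 0 ≠ 0` and `0 ≤ ρ`: growth normalisation and translation -/

/-- A growth bound with any exponent `ρ` implies one with the exponent `max ρ 0` (the unit disc is
handled by compactness). -/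
theorem growth_nonneg_exponent {F : ℂ → ℂ} (hF : Differentiable ℂ F) {ρ C : ℝ}
    (hgrowth : ∀ z, ‖F z‖ ≤ C * Real.exp (‖z‖ ^ ρ)) :
    ∃ C' : ℝ, 0 ≤ C' ∧ ∀ z, ‖F z‖ ≤ C' * Real.exp (‖z‖ ^ max ρ 0) := by
  obtain ⟨M, hM⟩ := (isCompact_closedBall (0 : ℂ) 1).exists_bound_of_continuousOn
    hF.continuous.continuousOn
  have hC : 0 ≤ C := by
    have h1 : (0 : ℝ) ≤ C * Real.exp (‖(0 : ℂ)‖ ^ ρ) := (norm_nonneg _).trans (hgrowth 0)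
    exact (mul_nonneg_iff_of_pos_right (Real.exp_pos _)).1 h1
  refine ⟨max C (max M 0), le_max_of_le_right (le_max_right _ _), fun z ↦ ?_⟩
  have hE : 1 ≤ Real.exp (‖z‖ ^ max ρ 0) := Real.one_le_exp (by positivity)
  by_cases hz : ‖z‖ ≤ 1
  · have h1 : ‖F z‖ ≤ M := hM z (by simpa using hz)
    calc ‖F z‖ ≤ max C (max M 0) := h1.trans ((le_max_left _ _).trans (le_max_right _ _))
      _ ≤ max C (max M 0) * Real.exp (‖z‖ ^ max ρ 0) :=
          le_mul_of_one_le_right (le_max_of_le_right (le_max_right _ _)) hE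
  · push Not at hz
    calc ‖F z‖ ≤ C * Real.exp (‖z‖ ^ ρ) := hgrowth z
      _ ≤ C * Real.exp (‖z‖ ^ max ρ 0) := by
          have hr : ‖z‖ ^ ρ ≤ ‖z‖ ^ max ρ 0 :=
            Real.rpow_le_rpow_of_exponent_le hz.le (le_max_left _ _)
          exact mul_le_mul_of_nonneg_left (Real.exp_le_exp.2 hr) hC
      _ ≤ max C (max M 0) * Real.exp (‖z‖ ^ max ρ 0) := by
          gcongr
          exact le_max_left _ _

/-- Translation with an exponent bump: `‖F (x + c)‖ ≤ C' e^{‖x‖^{ρ'}}` for any `ρ' > ρ ≥ 0`. -/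
theorem growth_translate {F : ℂ → ℂ} {ρ C : ℝ} (hρ0 : 0 ≤ ρ) (hC : 0 ≤ C)
    (hgrowth : ∀ z, ‖F z‖ ≤ C * Real.exp (‖z‖ ^ ρ)) (c : ℂ) {ρ' : ℝ} (hρ' : ρ < ρ') :
    ∃ C' : ℝ, ∀ x, ‖F (x + c)‖ ≤ C' * Real.exp (‖x‖ ^ ρ') := by
  set T : ℝ := max ((2 : ℝ) ^ (ρ / (ρ' - ρ))) (max ‖c‖ 1) with hT
  have hT1 : 1 ≤ T := le_max_of_le_right (le_max_right _ _)
  have hTc : ‖c‖ ≤ T := le_max_of_le_right (le_max_left _ _)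
  have hT2 : (2 : ℝ) ^ (ρ / (ρ' - ρ)) ≤ T := le_max_left _ _
  have hT0 : 0 < T := by linarith
  set D : ℝ := (T + ‖c‖) ^ ρ with hD
  have hD0 : 0 ≤ D := by positivity
  refine ⟨C * Real.exp D, fun x ↦ ?_⟩
  have hdiff : 0 < ρ' - ρ := by linarith
  have key : ‖x + c‖ ^ ρ ≤ ‖x‖ ^ ρ' + D := by
    have hxc : ‖x + c‖ ≤ ‖x‖ + ‖c‖ := norm_add_le _ _
    by_cases hx : ‖x‖ ≤ T
    · calc ‖x + c‖ ^ ρ ≤ (‖x‖ + ‖c‖) ^ ρ := Real.rpow_le_rpow (norm_nonneg _) hxc hρ0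
        _ ≤ (T + ‖c‖) ^ ρ := Real.rpow_le_rpow (by positivity) (by linarith) hρ0
        _ ≤ ‖x‖ ^ ρ' + D := le_add_of_nonneg_left (by positivity)
    · push Not at hx
      have hx0 : 0 < ‖x‖ := by linarith
      have h2x : ‖x‖ + ‖c‖ ≤ 2 * ‖x‖ := by linarith
      have hpow2 : (2 : ℝ) ^ ρ ≤ T ^ (ρ' - ρ) := by
        calc (2 : ℝ) ^ ρ = ((2 : ℝ) ^ (ρ / (ρ' - ρ))) ^ (ρ' - ρ) := by
              rw [← Real.rpow_mul (by norm_num : (0 : ℝ) ≤ 2)]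
              congr 1
              field_simp
          _ ≤ T ^ (ρ' - ρ) := Real.rpow_le_rpow (by positivity) hT2 hdiff.le
      have hTx : T ^ (ρ' - ρ) ≤ ‖x‖ ^ (ρ' - ρ) := Real.rpow_le_rpow hT0.le hx.le hdiff.le
      calc ‖x + c‖ ^ ρ ≤ (‖x‖ + ‖c‖) ^ ρ := Real.rpow_le_rpow (norm_nonneg _) hxc hρ0
        _ ≤ (2 * ‖x‖) ^ ρ := Real.rpow_le_rpow (by positivity) h2x hρ0
        _ = (2 : ℝ) ^ ρ * ‖x‖ ^ ρ := Real.mul_rpow (by norm_num) hx0.le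
        _ ≤ ‖x‖ ^ (ρ' - ρ) * ‖x‖ ^ ρ := by
            gcongr
            exact hpow2.trans hTx
        _ = ‖x‖ ^ ρ' := by
            rw [← Real.rpow_add hx0]
            congr 1
            ring
        _ ≤ ‖x‖ ^ ρ' + D := le_add_of_nonneg_right hD0
  calc ‖F (x + c)‖ ≤ C * Real.exp (‖x + c‖ ^ ρ) := hgrowth _
    _ ≤ C * Real.exp (‖x‖ ^ ρ' + D) := by gcongr
    _ = C * Real.exp D * Real.exp (‖x‖ ^ ρ') := by rw [Real.exp_add]; ring

/-- (K) alias for `Literature.Barriers.RiemannHypothesis.deriv_ne_zero_of_analyticOrderAt_eq_one`. -/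
private abbrev deriv_ne_zero_of_analyticOrderAt_eq_one := @Literature.Barriers.RiemannHypothesis.deriv_ne_zero_of_analyticOrderAt_eq_one

/-- For an entire `G` with `G 0 ≠ 0`, every zero has positive finite order (identity theorem). -/
theorem analyticOrderNatAt_pos_of_zero {G : ℂ → ℂ} (hG : Differentiable ℂ G) (h0 : G 0 ≠ 0) {a : ℂ}
    (ha : G a = 0) : 0 < analyticOrderNatAt G a := by
  have hGa : AnalyticAt ℂ G a := hG.analyticAt a
  have hne_top : analyticOrderAt G a ≠ ⊤ := by
    intro htop
    rw [analyticOrderAt_eq_top] at htop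
    have hEq : EqOn G 0 Set.univ :=
      AnalyticOnNhd.eqOn_zero_of_preconnected_of_eventuallyEq_zero
        (fun z _ ↦ hG.analyticAt z) isPreconnected_univ (Set.mem_univ a) htop
    exact h0 (by simpa using hEq (Set.mem_univ 0))
  have hne_zero : analyticOrderAt G a ≠ 0 := by
    rw [Ne, hGa.analyticOrderAt_eq_zero]
    exact fun h ↦ h ha
  unfold analyticOrderNatAt
  have : (analyticOrderAt G a).toNat ≠ 0 := by
    intro h
    rcases (ENat.toNat_eq_zero).1 h with h' | h'
    · exact hne_zero h'
    · exact hne_top h'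
  omega

/-- THE END-SERIES INPUT in inverse-zero coordinates: if `Σ ‖b n‖² < ∞` and every genuine inverse zero
`(b n)⁻¹` has norm `> r ≥ 0`, then `Σ_{b n ≠ 0} 1/((‖(b n)⁻¹‖ − r)·‖(b n)⁻¹‖) < ∞` (tail terms `≤ 2‖b n‖²`). -/
theorem summable_end_majorant (b : ℕ → ℂ) (hb : Summable fun n ↦ ‖b n‖ ^ 2) {r : ℝ} (hr : 0 ≤ r)
    (hsep : ∀ n, b n ≠ 0 → r < ‖(b n)⁻¹‖) :
    Summable fun n ↦ (if b n = 0 then (0 : ℝ) else 1) / ((‖(b n)⁻¹‖ - r) * ‖(b n)⁻¹‖) := by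
  have hev : ∀ᶠ n in atTop, ‖b n‖ ^ 2 < (1 / (2 * r + 2)) ^ 2 :=
    (hb.tendsto_atTop_zero).eventually (gt_mem_nhds (by positivity))
  refine Summable.of_norm_bounded_eventually_nat (g := fun n ↦ 2 * ‖b n‖ ^ 2) (hb.mul_left 2) ?_
  filter_upwards [hev] with n hn
  by_cases hb0 : b n = 0
  · simp [hb0]
  have ht : 0 < ‖b n‖ := norm_pos_iff.2 hb0
  have htlt : ‖b n‖ < 1 / (2 * r + 2) := by
    by_contra hge
    push Not at hge
    have : (1 / (2 * r + 2)) ^ 2 ≤ ‖b n‖ ^ 2 := by gcongr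
    linarith
  have hrt : r * ‖b n‖ ≤ 1 / 2 := by
    have h1 : ‖b n‖ * (2 * r + 2) < 1 := by rwa [lt_div_iff₀ (by positivity)] at htlt
    nlinarith
  have hsep' : r < ‖b n‖⁻¹ := by simpa [norm_inv] using hsep n hb0
  have hpos : 0 < (‖b n‖⁻¹ - r) * ‖b n‖⁻¹ := mul_pos (sub_pos.2 hsep') (inv_pos.2 ht)
  simp only [hb0, if_false, norm_inv]
  rw [Real.norm_of_nonneg (by positivity), div_le_iff₀ hpos]
  have key : 2 * ‖b n‖ ^ 2 * ((‖b n‖⁻¹ - r) * ‖b n‖⁻¹) = 2 * (1 - r * ‖b n‖) := by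
    field_simp
  rw [key]
  linarith

/-- FIBER FORMULA: a list-sum `Σ_i g(a_i)` is the sum over points `c` weighted by the fiber counts
`{i | a i = c}.ncard` (unconditional: `HasSum.tsum_fiberwise` + `tsum_const`). -/
theorem hasSum_fiber_ncard {ι : Type*} (a : ι → ℂ) (g : ℂ → ℝ) (hs : Summable fun i ↦ g (a i)) :
    HasSum (fun c : ℂ ↦ ({i | a i = c}.ncard : ℝ) * g c) (∑' i, g (a i)) := by
  have h := hs.hasSum.tsum_fiberwise a
  have hfun : (fun c : ℂ ↦ ∑' i : a ⁻¹' {c}, g (a i)) = fun c ↦ ({i | a i = c}.ncard : ℝ) * g c := by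
    funext c
    have hc : ∀ i : a ⁻¹' {c}, g (a i) = g c := fun i ↦ by
      have hi : a i = c := i.2
      rw [hi]
    rw [tsum_congr hc, tsum_const, nsmul_eq_mul, Nat.card_coe_set_eq]
    rfl
  rw [hfun] at h
  exact h

end GenusOneLogDerivC3g41

end Literature.Analysis.Complex
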